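import Summits.BirchSwinnertonDyer.BirchSwinnertonDyer.Theorems.RamifiedHeegnerPairLeafPartnerOrdersCongruenceLattice
import Summits.BirchSwinnertonDyer.BirchSwinnertonDyer.Theorems.RamifiedHeegnerPairLeafPartnerOrdersLocalFactor
import Summits.BirchSwinnertonDyer.BirchSwinnertonDyer.Theorems.RamifiedHeegnerPairLeafPartnerOrdersCornerModule
import Literature.RingTheory.SimpleModule.LocalRingModuloRadical
import Mathlib.LinearAlgebra.FreeModule.PID
import Mathlib.RingTheory.Finiteness.Basic
import HarnessLib

/-!
# Route `RamifiedHeegnerPair`, crux U₁ `LeafRankOneUpperAtThree` (stmt-BirchSwinnertonDyer-26022), line `partnerdescent` —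
# partner kernel: the LOCAL RUN — from `3`-adic global data to «the degree divides the lattice denominator»

HONEST FRAMING. Theorems only; helper file (`--supports stmt-BirchSwinnertonDyer-26022 --as helper`); pure commutative algebra composing the
four landed files ‹…CongruenceLattice› (p810424), ‹…LocalFactor› (p810777), ‹…CornerModule› (p811103) and the Gorenstein core (p801603); no number
theory, no named fact, no `sorry`; nothing booked; BSD is proved for no curve. Lead prover bsd-line-rhp-p2 g63, 2026-08-31.

WHY. The stub (G3♭ᶜ) `Partnerdescent.stub_cokernelFifthInCoordinates` («`3 ∤ j`», i.e. `ord₃ δ = ord₃ R` with `R = ξ/i`) is derived in two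
layers (LEAD-G63-ASSEMBLY.md §4): (α) BASE CHANGE — from the integral Brandt data and the typed inputs (C2′)(C3′)(C5′)(C0) to `3`-adic data:
a finite free `ℤ₃`-algebra `A = 𝕋̂` acting faithfully on a finite free `ℤ₃`-module `M = B̂` with an `A`-invariant non-degenerate pairing that is
exact-Eisenstein for some `u ∉ 𝔫` (`𝔫 = 𝔪_{f,3}`), multiplicity one at `𝔫` in cosocle form, a saturated `A`-submodule `Y = Ŷ` with a projector
`u_Y` (`u_Y|_Y = N₀`, `u_Y M ⊆ Y`), the eigen-element `t = N·e_f` with its character `χ` (`s t = χ(s) t`, `𝔫 = χ⁻¹(𝔪_{ℤ₃})`), the relation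
`δ·t = N·P` on `Y` (`P = π^* ∘ π_*`), the lattice side «`(a t)·Y ⊆ N·Y ⟺ R ∣ a`» (p801913) and (C5′) «`δ·s = a·P` on `Y` ⟹ `δ ∣ a`»;
(β) the LOCAL RUN — THIS FILE, `dvd_of_localRun`: from such data, **`δ ∣ R`** (and `R ∣ δ` is Takahashi's `δ = R·j`), hence `ord₃ δ = ord₃ R`,
`3 ∤ j`. The run: the idempotent `e` at `𝔫` (‹LocalFactor›), the corner ring `T = A ⧸ (1 − e)` (local, finite free) and corner modules `B = eM`,
`Y_e` (‹CornerModule›: cyclic by Nakayama, faithful, perfect pairing via `bijective_of_forall_exists_eq_comp`, `B[Ann Y_e] ⊆ Y_e`), freeness of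
`T ⧸ Ann Y_e` (torsion-free and finite over the PID), the assembled theorem (‹CongruenceLattice›) at `a = R`, and the unpacking of the
congruence side `R·t̄ ∈ N·T + Ann Y_e` into a GLOBAL Hecke element `s = y₀ e` with `δ·s = R·P` on `Y`, to which (C5′) applies. So after
this file the successor's work on (G3♭ᶜ) is (α) alone — constructing the `3`-adic data from the integral Brandt data and the typed facts.
[cite: PapikianRabinoff2016, §3 ¶23–¶25, Lemma 24, Thm. 30, Lemma 32 (arXiv:1212.3574 pp. 8–9)] [cite: Matsumura1987, Thm. 2.3, Thm. 8.15, §18 Thm. 18.1]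
[cite: StacksProject, Tag 04GG]
-/

set_option linter.dupNamespace false
set_option autoImplicit false

noncomputable section

namespace Summit.BirchSwinnertonDyer.BirchSwinnertonDyer.Theorems.LeafPartnerOrders

open IsLocalRing Submodule

section Eigen

variable {R : Type*} [CommRing R] [IsLocalRing R] {A : Type*} [CommRing A] [Algebra R A]

/-- **The eigen-element is supported at its maximal ideal.** If `t ∈ A` is an eigen-element for the character `χ : A → R` (`s·t = χ(s)·t`),
`𝔫 = χ⁻¹(𝔪_R)`, and `e` is an idempotent with `1 − e ∈ 𝔫`, then `e·t = t` (`χ(e)` is an idempotent of the local ring `R` not in `𝔪_R`, so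
`χ(e) = 1`; tree lemma `Literature.RingTheory.SimpleModule.IsIdempotentElem.eq_zero_or_eq_one_of_isLocalRing`, Lam (19.2)(c)). In the derivation `t = N·e_f`, `χ = χ_f` the eigencharacter of `f` on `𝕋̂`, `𝔫 = 𝔪_{f,3}`: `e_f` lives on the factor `𝕋_𝔪`.
[cite: Matsumura1987, Thm. 8.15] -/
theorem mul_eq_self_of_eigen (χ : A →ₐ[R] R) {t : A} (hχt : ∀ s : A, s * t = χ s • t) (𝔫 : Ideal A)
    (h𝔫 : ∀ s : A, s ∈ 𝔫 ↔ χ s ∈ maximalIdeal R) {e : A} (he : IsIdempotentElem e) (h1e : 1 - e ∈ 𝔫) : e * t = t := by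
  have hχe : IsIdempotentElem (χ e) := by
    change χ e * χ e = χ e
    rw [← map_mul, he.eq]
  have hχ1e : χ (1 - e) ∈ maximalIdeal R := (h𝔫 _).mp h1e
  rw [map_sub, map_one] at hχ1e
  rcases Literature.RingTheory.SimpleModule.IsIdempotentElem.eq_zero_or_eq_one_of_isLocalRing hχe with h0 | h1
  · exfalso
    rw [h0, sub_zero] at hχ1e
    exact (maximalIdeal.isMaximal R).ne_top ((Ideal.eq_top_iff_one _).mpr hχ1e)
  · rw [hχt e, h1, one_smul]

end Eigen

section Run

variable {R : Type*} [CommRing R] [IsDomain R] [IsPrincipalIdealRing R] [IsLocalRing R]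
  [IsAdicComplete (maximalIdeal R) R]
  {A : Type*} [CommRing A] [Algebra R A] [Module.Finite R A] [Module.Free R A]
  {M : Type*} [AddCommGroup M] [Module R M] [Module A M] [IsScalarTower R A M] [Module.Finite R M]

/-- **The local run.** Data (all over a complete local principal ideal domain `R`, e.g. `ℤ₃`): a commutative finite free `R`-algebra `A`
acting faithfully on a finite `R`-torsion-free module `M`; an `A`-invariant `R`-bilinear pairing `β` on `M`, non-degenerate, and
EXACT-EISENSTEIN for `u ∈ A` (`∀ φ ∃ x, β(x, ·) = φ(u ·)`); a maximal ideal `𝔫` with `u ∉ 𝔫` and MULTIPLICITY ONE in cosocle form (`M = A x₀ + 𝔫M`);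
an `A`-submodule `Y` with a projector `u_Y` (`u_Y = N₀` on `Y`, `u_Y M ⊆ Y`, `Y` `N₀`-saturated); an eigen-element `t` with character `χ`,
`𝔫 = χ⁻¹(𝔪_R)`; `P : M → M` with `δ·(t y) = N·P y` on `Y`, `N ≠ 0`; the LATTICE SIDE «`(Rl·t)·Y ⊆ N·Y`» at the scalar `Rl`; and (C5′)
«`δ·(s y) = a·P y` on `Y` for some `s ∈ A` ⟹ `δ ∣ a`». CONCLUSION: `δ ∣ Rl`. In the derivation: `A = 𝕋̂ = ℤ₃ ⊗ 𝕋`, `M = X̂_q(J_0(qrM))`, `β` =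
Gross's pairing (exact Eisenstein p806900, `u = T_ℓ − ℓ − 1`), `𝔫 = 𝔪_{f,3}` ((C3′) multiplicity one), `Y = X̂_r(J′)` ((C2′)), `t = N·e_f`,
`P = π^*π_*`, `δ = δ_{qr,M}`, `Rl = ξ/i` (lattice side by `forall_dvd_mul_pairing_iff`), (C5′) = «the JL-degree divides the new congruence
number»; with Takahashi's `δ = Rl·j`: `ord₃ δ = ord₃ Rl`, `3 ∤ j` — the stub (G3♭ᶜ). Proof: ‹LocalFactor› + ‹CornerModule› + ‹CongruenceLattice›, then
lift the congruence side to the global element `s = y₀ e`. [cite: PapikianRabinoff2016, §3 ¶23–¶25, Lemma 24, Lemma 32] [cite: StacksProject, Tag 04GG]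
[cite: Matsumura1987, Thm. 2.3, §18 Thm. 18.1] -/
theorem dvd_of_localRun
    (htf : ∀ (r : R) (m : M), r • m = 0 → r = 0 ∨ m = 0)
    (hfaith : ∀ s : A, (∀ m : M, s • m = 0) → s = 0)
    (β : M →ₗ[R] M →ₗ[R] R) (hinv : ∀ (s : A) (x y : M), β (s • x) y = β x (s • y))
    (hnd : ∀ x : M, (∀ y : M, β x y = 0) → x = 0)
    (u : A) (hEis : ∀ φ : Module.Dual R M, ∃ x : M, ∀ y : M, β x y = φ (u • y))
    (𝔫 : Ideal A) [𝔫.IsMaximal] (hu : u ∉ 𝔫)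
    (x₀ : M) (hmult : ∀ x : M, ∃ c : A, x - c • x₀ ∈ 𝔫 • (⊤ : Submodule A M))
    (Y : Submodule A M) (uY : A) (N₀ : R) (huY : ∀ y ∈ Y, uY • y = N₀ • y) (huYM : ∀ m : M, uY • m ∈ Y)
    (hsat : ∀ m : M, N₀ • m ∈ Y → m ∈ Y)
    (χ : A →ₐ[R] R) (t : A) (hχt : ∀ s : A, s * t = χ s • t) (h𝔫 : ∀ s : A, s ∈ 𝔫 ↔ χ s ∈ maximalIdeal R)
    (P : M → M) (N δ : R) (hN : N ≠ 0) (hP : ∀ y ∈ Y, δ • (t • y) = N • P y)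
    (Rl : R) (hlat : ∀ y ∈ Y, ∃ y' ∈ Y, (Rl • t) • y = N • y')
    (hC5 : ∀ (s : A) (a : R), (∀ y ∈ Y, δ • (s • y) = a • P y) → δ ∣ a) :
    δ ∣ Rl := by
  classical
  -- (0) the local factor at `𝔫`
  obtain ⟨e, he, h1e, hsep, hloc, hfree⟩ := exists_isIdempotentElem_localFactor (R := R) 𝔫
  haveI := hloc
  haveI := hfree
  have hcomap := comap_maximalIdeal_eq 𝔫 hsep
  -- notation: the corner ring `T` and the corner module `B`
  set I : Ideal A := Ideal.span {1 - e} with hI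
  let T := A ⧸ I
  let B := torsionBySet A M (I : Set A)
  -- `R`-torsion-freeness of `M`, as an instance
  haveI : Module.IsTorsionFree R M := Module.IsTorsionFree.of_smul_eq_zero htf
  -- (1) `B` is finite over `R`, hence over `T`
  haveI : IsNoetherianRing R := inferInstance
  haveI : Module.Finite R B := Module.Finite.of_injective (B.subtype.restrictScalars R) Subtype.val_injective
  haveI : Module.Finite T B := Module.Finite.of_restrictScalars_finite R T B
  -- (2) the generator `b = e x₀` and cyclicity by Nakayama
  let b : B := ⟨e • x₀, smul_mem_corner (M := M) he x₀⟩
  have hspan : Submodule.span T {b} = ⊤ :=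
    span_singleton_eq_top_of_sup_maximalIdeal_smul_top b
      (corner_span_sup_maximalIdeal_smul_eq_top (M := M) he 𝔫 hcomap hmult)
  -- (3) faithfulness of `T` on `b`
  have hfaithT : ∀ s : T, s • b = 0 → s = 0 := by
    intro s hs
    obtain ⟨s', rfl⟩ := Ideal.Quotient.mk_surjective s
    apply mk_eq_zero_of_forall_corner_smul_eq_zero (M := M) he hfaith
    intro m hm
    -- `m ∈ B = span {b}`: `⟨m, hm⟩ = c • b`
    have hmem : (⟨m, hm⟩ : B) ∈ Submodule.span T {b} := hspan ▸ Submodule.mem_top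
    obtain ⟨c, hc⟩ := Submodule.mem_span_singleton.mp hmem
    obtain ⟨c', rfl⟩ := Ideal.Quotient.mk_surjective c
    have h0 : (Ideal.Quotient.mk I s') • ((Ideal.Quotient.mk I c') • b) = 0 := by
      rw [smul_comm, hs, smul_zero]
    rw [hc] at h0
    exact congrArg Subtype.val h0
  -- (4) the pairing on `B`
  let βB : B →ₗ[R] B →ₗ[R] R := (β ∘ₗ B.subtype.restrictScalars R).compl₂ (B.subtype.restrictScalars R)
  have hβB : ∀ x y : B, βB x y = β (x : M) (y : M) := fun x y ↦ rfl
  have hinvB : ∀ (s : T) (x y : B), βB (s • x) y = βB x (s • y) := by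
    intro s x y
    obtain ⟨s', rfl⟩ := Ideal.Quotient.mk_surjective s
    rw [hβB, hβB]
    exact hinv s' x y
  -- the action of `u` on `B` as an `R`-linear bijection
  let uB : B →ₗ[R] B :=
    { toFun := fun y ↦ Ideal.Quotient.mk I u • y
      map_add' := fun y y' ↦ smul_add _ y y'
      map_smul' := fun c y ↦ smul_comm _ c y }
  have huB : ∀ y : B, uB y = Ideal.Quotient.mk I u • y := fun y ↦ rfl
  have hunit : IsUnit (Ideal.Quotient.mk I u) := isUnit_mk_span_of_not_mem 𝔫 hsep hu
  have huBbij : Function.Bijective uB := by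
    obtain ⟨v, hv⟩ := hunit
    constructor
    · intro x y hxy
      have := congrArg (fun z ↦ (↑v⁻¹ : T) • z) hxy
      simpa [huB, ← hv, smul_smul] using this
    · intro y
      refine ⟨(↑v⁻¹ : T) • y, ?_⟩
      rw [huB, ← hv, smul_smul, Units.mul_inv, one_smul]
  have hperfB : Function.Bijective βB := by
    refine bijective_of_forall_exists_eq_comp βB ?_ uB huBbij ?_
    · -- injective: non-degeneracy descends to the corner
      intro x y hxy
      have h0 : βB (x - y) = 0 := by rw [map_sub, hxy, sub_self]
      have : ((x - y : B) : M) = 0 := by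
        refine corner_pairing_nondegenerate (M := M) he β hinv hnd (x - y).2 fun z hz ↦ ?_
        have := LinearMap.congr_fun h0 ⟨z, hz⟩
        rwa [hβB] at this
      exact sub_eq_zero.mp (Subtype.ext this)
    · -- exact Eisenstein descends to the corner
      intro φ
      obtain ⟨x, hx, hxφ⟩ := corner_pairing_eisenstein (M := M) he β hinv u hEis φ
      refine ⟨⟨x, hx⟩, ?_⟩
      ext y
      rw [hβB, LinearMap.comp_apply, huB]
      exact hxφ y y.2
  -- (5) the corner submodule `Y_e` of `B`, as a `T`-submodule
  let Ye : Submodule T B :=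
    { carrier := {y | (y : M) ∈ Y}
      add_mem' := fun {x y} hx hy ↦ Y.add_mem hx hy
      zero_mem' := Y.zero_mem
      smul_mem' := fun c {x} hx ↦ by
        obtain ⟨c', rfl⟩ := Ideal.Quotient.mk_surjective c
        exact Y.smul_mem c' hx }
  have hYe : ∀ y : B, y ∈ Ye ↔ (y : M) ∈ Y := fun y ↦ Iff.rfl
  -- `B[Ann Y_e] ⊆ Y_e` from the projector and saturation
  have hBY : ∀ x : B, (∀ j ∈ Ye.annihilator, j • x = 0) → x ∈ Ye := by
    intro x hx
    refine mem_of_forall_annihilator_smul_eq_zero Ye (Ideal.Quotient.mk I uY) (algebraMap R T N₀) ?_ ?_ ?_ x hx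
    · intro y hy
      apply Subtype.ext
      change uY • (y : M) = ((algebraMap R T N₀) • y : B)
      rw [algebraMap_smul, huY _ ((hYe y).mp hy)]
      rfl
    · intro z
      exact huYM z
    · intro z hz
      rw [hYe]
      apply hsat
      have : ((algebraMap R T N₀ • z : B) : M) ∈ Y := hz
      rwa [algebraMap_smul] at this
  -- (6) `T ⧸ Ann Y_e` is finite free over `R`
  haveI : Module.Finite R T :=
    Module.Finite.of_surjective (Ideal.Quotient.mkₐ R I).toLinearMap Ideal.Quotient.mk_surjective
  haveI : Module.Finite R (T ⧸ Ye.annihilator) :=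
    Module.Finite.of_surjective (Ideal.Quotient.mkₐ R Ye.annihilator).toLinearMap Ideal.Quotient.mk_surjective
  haveI : Module.IsTorsionFree R (T ⧸ Ye.annihilator) := by
    refine Module.IsTorsionFree.of_smul_eq_zero fun r w hrw ↦ ?_
    by_cases hr : r = 0
    · exact Or.inl hr
    · right
      obtain ⟨w', rfl⟩ := Ideal.Quotient.mk_surjective w
      rw [Ideal.Quotient.eq_zero_iff_mem, Submodule.mem_annihilator]
      intro y hy
      have h1 : (r • w') • y = 0 := by
        have : Ideal.Quotient.mk Ye.annihilator (r • w') = 0 := by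
          rw [← Ideal.Quotient.mkₐ_eq_mk R, map_smul, Ideal.Quotient.mkₐ_eq_mk, hrw]
        rw [Ideal.Quotient.eq_zero_iff_mem, Submodule.mem_annihilator] at this
        exact this y hy
      rw [smul_assoc] at h1
      have h2 : r • ((w' • y : B) : M) = 0 := by
        have := congrArg Subtype.val h1
        simpa using this
      rcases htf r _ h2 with h | h
      · exact absurd h hr
      · exact Subtype.ext h
  haveI : Module.Free R (T ⧸ Ye.annihilator) := Module.free_of_finite_type_torsion_free'
  -- (7) the assembled theorem at `a = Rl`
  have hlatB : ∀ y ∈ Ye, ∃ y' ∈ Ye, (Rl • Ideal.Quotient.mk I t) • y = N • y' := by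
    intro y hy
    obtain ⟨y', hy', hyy'⟩ := hlat (y : M) ((hYe y).mp hy)
    -- `y' ∈ B`: `N y' = (Rl t) y ∈ B` and `B` is `N`-saturated (`M` torsion-free)
    have hy'B : y' ∈ B := by
      rw [mem_corner_iff]
      have h1 : e • ((Rl • t) • (y : M)) = (Rl • t) • (y : M) := by
        rw [← mul_smul, mul_comm, mul_smul, (mem_corner_iff e (y : M)).mp y.2]
      rw [hyy', smul_comm] at h1
      have h2 : N • (e • y' - y') = 0 := by rw [smul_sub, h1, sub_self]
      rcases htf N _ h2 with h | h
      · exact absurd h hN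
      · exact sub_eq_zero.mp h
    refine ⟨⟨y', hy'B⟩, (hYe _).mpr hy', Subtype.ext ?_⟩
    change (Rl • t) • (y : M) = N • y'
    exact hyy'
  obtain ⟨y₀, hy₀⟩ :=
    (smul_sub_mem_annihilator_iff_forall_smul_mem b hspan hfaithT βB hperfB hinvB Ye hBY
      (Ideal.Quotient.mk I t) N Rl).mpr hlatB
  -- (8) unpack: a global Hecke element `s = y₀' e` with `δ s = Rl P` on `Y`
  obtain ⟨y₀', rfl⟩ := Ideal.Quotient.mk_surjective y₀
  have hte : e * t = t := mul_eq_self_of_eigen χ hχt 𝔫 h𝔫 he h1e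
  refine hC5 (y₀' * e) Rl fun y hy ↦ ?_
  -- `e y ∈ Y_e`, so `(Rl t − N y₀') (e y) = 0`
  have hey : (⟨e • y, smul_mem_corner (M := M) he y⟩ : B) ∈ Ye := (hYe _).mpr (Y.smul_mem e hy)
  have h0 := (Submodule.mem_annihilator.mp hy₀) _ hey
  have hz : Rl • Ideal.Quotient.mk I t - N • Ideal.Quotient.mk I y₀' = Ideal.Quotient.mk I (Rl • t - N • y₀') := by
    rw [← Ideal.Quotient.mkₐ_eq_mk R, map_sub, map_smul, map_smul]
  rw [hz] at h0
  have h1 : ((Rl • t - N • y₀') • (e • y) : M) = 0 := congrArg Subtype.val h0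
  -- `(Rl t)(e y) = Rl (t y)` and `(N y₀')(e y) = N ((y₀' e) y)`
  have h2 : N • ((y₀' * e) • y) = Rl • (t • y) := by
    rw [sub_smul, sub_eq_zero, smul_assoc, smul_assoc, ← mul_smul t e y, mul_comm t e, hte, ← mul_smul] at h1
    exact h1.symm
  -- multiply `δ s y = Rl P y` by `N` and cancel
  have h3 : N • (δ • ((y₀' * e) • y)) = N • (Rl • P y) := by
    rw [smul_comm, h2, smul_comm, hP y hy, smul_comm]
  have h4 : N • (δ • ((y₀' * e) • y) - Rl • P y) = 0 := by rw [smul_sub, h3, sub_self]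
  rcases htf N _ h4 with h | h
  · exact absurd h hN
  · exact sub_eq_zero.mp h

end Run

end Summit.BirchSwinnertonDyer.BirchSwinnertonDyer.Theorems.LeafPartnerOrders

end
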